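import Summits.AtomisticToContinuum.BoseEinsteinCondensation.Theses.BECStronglyRayleigh
import Summits.AtomisticToContinuum.BoseEinsteinCondensation.Theorems.BECStronglyRayleighGroundStateStabilityConeSelection
import Literature.MathematicalPhysics.QuantumLattice.LieTrotter
import Literature.MathematicalPhysics.QuantumLattice.KroneckerTraceSchwarz
import HarnessLib

/-!
# The one-generator Euler limit: stub `stub_eulerLimit` of line
# `stable-cone-variational-selection` for crux `GroundStateStability` (stmt-AtomisticToContinuum-9672)

Stub B1 of the skeleton `Cruxes/GroundStateStability/Lines/stable-cone-variational-selection.lean`: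
if every Euler gate `1 + εX`, `0 ≤ ε ≤ 1`, maps coefficient vectors with `H^Λ`-stable occupation
polynomial to `0` or to such vectors, then `exp(tX)`, `t ≥ 0`, maps stable vectors to stable
vectors.

Proof.
* Gate iteration: a matrix mapping a set `K` of vectors into itself has all its powers mapping `K`
  into itself; here `K = {0} ∪ {stable}` (the gate maps `0 ↦ 0`).
* Euler's limit `(1 + a/N)^N → exp a` in the Banach algebra `Matrix n n ℂ` with the sup operator
  norm (`Matrix.Norms.Operator`, whose topology is the entrywise one): the case `F_N = 1 + a/N`,
  `C = 0` of the Euler–Lie product formula `tendsto_pow_exp_of_norm_sub_le`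
  (`Literature/MathematicalPhysics/QuantumLattice/KroneckerTraceSchwarz.lean`, telescoping estimate
  of Reed–Simon I, Theorem VIII.29).
* With `a = tX` and `N ≥ max 1 ⌈t⌉`, `1 + a/N` is the gate with step `ε = t/N ∈ [0, 1]`, so
  `(1 + a/N)^N φ ∈ K` eventually; `M ↦ M φ` is continuous and `K` is closed
  (`coneSel_isClosed_zero_or_stable`, Hurwitz), hence `exp(tX) φ ∈ K`.
* `exp(tX)` is invertible (`Matrix.isUnit_exp`), so `exp(tX) φ ≠ 0` for the nonzero (because
  stable, `coneSel_ne_zero_of_stable`) vector `φ`: the stable alternative holds.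
-/

noncomputable section

namespace Summit.AtomisticToContinuum.BoseEinsteinCondensation.Cruxes.GroundStateStability.StableConeVariationalSelection

open scoped BigOperators Matrix ComplexOrder
open Literature.MathematicalPhysics.QuantumLattice
open Filter Topology

/-! ### Gate iteration -/

/-- Powers of a matrix mapping a set of vectors into itself map that set into itself. [folklore] -/
theorem eulerLim_pow_mulVec_mem {ι : Type*} [Fintype ι] [DecidableEq ι] {K : Set (ι → ℂ)}
    {A : Matrix ι ι ℂ} (hA : ∀ v ∈ K, A *ᵥ v ∈ K) (k : ℕ) : ∀ v ∈ K, A ^ k *ᵥ v ∈ K := by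
  induction k with
  | zero =>
    intro v hv
    rwa [pow_zero, Matrix.one_mulVec]
  | succ k ih =>
    intro v hv
    rw [pow_succ', ← Matrix.mulVec_mulVec]
    exact hA _ (ih v hv)

/-! ### Euler's limit for the matrix exponential -/

/-- **Euler's limit for the matrix exponential**: `(1 + a/N)^N → exp a` as `N → ∞` (proved in the
sup operator norm `Matrix.Norms.Operator`; the limit is in the entrywise topology). The special case
`F_N = 1 + a/N` (zero defect) of the Euler–Lie product formula `tendsto_pow_exp_of_norm_sub_le`.
Reed–Simon I, Theorem VIII.29. [folklore] -/
theorem eulerLim_tendsto_one_add_pow {n : Type*} [Fintype n] [DecidableEq n] [Nonempty n]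
    (a : Matrix n n ℂ) :
    Tendsto (fun N : ℕ => (1 + ((N : ℂ))⁻¹ • a) ^ N) atTop (𝓝 (NormedSpace.exp a)) := by
  letI : NormedRing (Matrix n n ℂ) := Matrix.linftyOpNormedRing
  letI : NormedAlgebra ℂ (Matrix n n ℂ) := Matrix.linftyOpNormedAlgebra
  haveI : NormOneClass (Matrix n n ℂ) := Matrix.linfty_opNormOneClass
  refine tendsto_pow_exp_of_norm_sub_le (𝕂 := ℂ) a (C := 0) fun N _ => ?_
  rw [sub_self, norm_zero, zero_div]

/-- **The semigroup inherits the gate invariance of a closed set.** If `K` is a closed set of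
vectors and every Euler gate `1 + εX`, `0 ≤ ε ≤ 1`, maps `K` into itself, then so does `exp(tX)` for
every `t ≥ 0`: `exp(tX) v = lim_N (1 + (t/N)X)^N v` and `(1 + (t/N)X)^N v ∈ K` once `N ≥ t`.
[folklore] -/
theorem eulerLim_exp_mulVec_mem {ι : Type*} [Fintype ι] [DecidableEq ι] [Nonempty ι]
    {K : Set (ι → ℂ)} (hK : IsClosed K) (X : Matrix ι ι ℂ)
    (hgate : ∀ ε : ℝ, 0 ≤ ε → ε ≤ 1 → ∀ v ∈ K, (1 + (ε : ℂ) • X) *ᵥ v ∈ K)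
    {t : ℝ} (ht : 0 ≤ t) {v : ι → ℂ} (hv : v ∈ K) :
    NormedSpace.exp ((t : ℂ) • X) *ᵥ v ∈ K := by
  have hlim : Tendsto (fun N : ℕ => (1 + ((N : ℂ))⁻¹ • ((t : ℂ) • X)) ^ N *ᵥ v) atTop
      (𝓝 (NormedSpace.exp ((t : ℂ) • X) *ᵥ v)) :=
    ((continuous_id.matrix_mulVec continuous_const).tendsto _).comp
      (eulerLim_tendsto_one_add_pow ((t : ℂ) • X))
  refine hK.mem_of_tendsto hlim ?_
  filter_upwards [eventually_ge_atTop (max 1 ⌈t⌉₊)] with N hN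
  have hN1 : 1 ≤ N := le_of_max_le_left hN
  have hNt : t ≤ N := Nat.ceil_le.mp (le_of_max_le_right hN)
  have hNpos : (0 : ℝ) < N := by exact_mod_cast hN1
  have heq : (1 + ((N : ℂ))⁻¹ • ((t : ℂ) • X) : Matrix ι ι ℂ) = 1 + ((t / N : ℝ) : ℂ) • X := by
    rw [smul_smul, Complex.ofReal_div, Complex.ofReal_natCast, div_eq_inv_mul]
  rw [heq]
  exact eulerLim_pow_mulVec_mem (hgate (t / N) (div_nonneg ht hNpos.le)
    (div_le_one_of_le₀ hNt hNpos.le)) N v hv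

/-! ### The stub -/

/-- **Stub B1 — the one-generator Euler limit.** If every Euler gate `1 + εX`, `0 ≤ ε ≤ 1`, maps
vectors with `H^Λ`-stable occupation polynomial to `0` or to such vectors, then the whole semigroup
`exp(tX)`, `t ≥ 0`, maps stable to stable: `(1 + (t/N)X)^N → exp(tX)` (Euler's limit in the sup
operator norm), for `N ≥ t` the `N`-fold gate image is `0` or stable, the set "`0` or stable" is
closed (`coneSel_isClosed_zero_or_stable`, Hurwitz), and `exp(tX)` is invertible
(`Matrix.isUnit_exp`), so the limit is not `0`. [folklore] -/
theorem stub_eulerLimit :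
    ∀ (Λ : Type) [Fintype Λ] [DecidableEq Λ] (X : Op Λ 2),
      (∀ ε : ℝ, 0 ≤ ε → ε ≤ 1 → ∀ φ : TensorIndex Λ 2 → ℂ,
        (∀ z : Λ → ℂ, (∀ i, 0 < (z i).im) →
          (∑ S : Finset Λ, φ (fun i => if i ∈ S then 0 else 1) * ∏ i ∈ S, z i) ≠ 0) →
        ((1 + (ε : ℂ) • X) *ᵥ φ = 0 ∨
          (∀ z : Λ → ℂ, (∀ i, 0 < (z i).im) →
          (∑ S : Finset Λ, ((1 + (ε : ℂ) • X) *ᵥ φ) (fun i => if i ∈ S then 0 else 1) * ∏ i ∈ S, z i) ≠ 0))) →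
      ∀ t : ℝ, 0 ≤ t → ∀ φ : TensorIndex Λ 2 → ℂ,
        (∀ z : Λ → ℂ, (∀ i, 0 < (z i).im) →
          (∑ S : Finset Λ, φ (fun i => if i ∈ S then 0 else 1) * ∏ i ∈ S, z i) ≠ 0) →
        (∀ z : Λ → ℂ, (∀ i, 0 < (z i).im) →
          (∑ S : Finset Λ, (NormedSpace.exp ((t : ℂ) • X) *ᵥ φ) (fun i => if i ∈ S then 0 else 1) * ∏ i ∈ S, z i) ≠ 0) := by
  intro Λ _ _ X hX t ht φ hφ
  -- the closed set "`0` or stable"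
  set K : Set (TensorIndex Λ 2 → ℂ) := {φ : TensorIndex Λ 2 → ℂ | φ = 0 ∨
      ∀ z : Λ → ℂ, (∀ i, 0 < (z i).im) →
        (∑ S : Finset Λ, φ (fun i => if i ∈ S then 0 else 1) * ∏ i ∈ S, z i) ≠ 0} with hKdef
  have hK : IsClosed K := coneSel_isClosed_zero_or_stable Λ
  -- the gates map `K` into `K`
  have hgate : ∀ ε : ℝ, 0 ≤ ε → ε ≤ 1 → ∀ v ∈ K, (1 + (ε : ℂ) • X) *ᵥ v ∈ K := by
    intro ε h0 h1 v hv
    rcases hv with hv | hv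
    · rw [hv, Matrix.mulVec_zero]
      exact Or.inl rfl
    · exact hX ε h0 h1 v hv
  haveI : Nonempty (TensorIndex Λ 2) := ⟨fun _ => 0⟩
  have hmem : NormedSpace.exp ((t : ℂ) • X) *ᵥ φ ∈ K :=
    eulerLim_exp_mulVec_mem hK X hgate ht (Or.inr hφ)
  rcases hmem with h0 | hst
  · -- `exp(tX)` is invertible and `φ ≠ 0`: the image is not `0`
    exfalso
    have hinj : Function.Injective (NormedSpace.exp ((t : ℂ) • X)).mulVec :=
      Matrix.mulVec_injective_iff_isUnit.mpr (Matrix.isUnit_exp _)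
    refine coneSel_ne_zero_of_stable hφ (hinj ?_)
    rw [h0, Matrix.mulVec_zero]
  · exact hst

end Summit.AtomisticToContinuum.BoseEinsteinCondensation.Cruxes.GroundStateStability.StableConeVariationalSelection
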